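import Summits.NavierStokesRegularity.NavierStokesRegularity.Theorems.ScenarioCensusRowA8HonestCell
import Summits.NavierStokesRegularity.NavierStokesRegularity.Theorems.AxisymmetricLiouvilleBoundedSwirl
import Summits.NavierStokesRegularity.NavierStokesRegularity.Theorems.ScenarioCensusAncient

/-!
# Screw Oseen gauge — part 4/4: census row A5 (the KNSS bounded-swirl leaf) ≡ its honest cell A5gen

`axisymmetricLiouvilleBoundedSwirl_iff_row_A5gen : AxisymmetricLiouvilleBoundedSwirl ↔ Row_A5gen` and the census
aliases `ScenarioCensus.axisymmetricLiouvilleBoundedSwirl_iff_row_A5gen`, `ScenarioCensus.row_A5_iff_row_A5gen :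
`Row_A5 ↔ RowA5HonestCell.Row_A5gen` (`Row_A5` is BY NAME the leaf, `Theorems/ScenarioCensusAncient.lean`).

Part 4 of the four-file re-homing of ns-idea-3's `ScenarioCensusScrewGauge.lean` (sha16 27b7018076f2c110; LINE 6
«honest-swirl» rev 1); overview and provenance in part 1 (`ScenarioCensusRowA8HonestGauge.lean`).  Contents
(verbatim, in namespace `…ScenarioCensus.RowA5HonestCell` over the `RowA8HonestCell` toolkit): the cell
`Row_A5gen` (a genuine bounded continuous Oseen-mild field on `(−∞,T)`, EXACTLY axisymmetric about the fixed
`x₃`-axis, with bounded swirl, has constant slices); §5 swirl transport through the gauge; `screw_zero_iff`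
(pitch 0 = axisymmetry); §6 kernel glue `leaf_of_honest` (O1/O2 at pitch 0, axis dichotomy O3, boosts O5, F,
directional Liouville, swirl transport), both directions and the headline.
No census value changes: row A5 / `Row_A5gen` remain OPEN (they are now one statement).
NS regularity is NOT proved; no summit statement is proved by this file.
-/

noncomputable section

open MeasureTheory Set Filter Topology Function Metric
open scoped ENNReal NNReal

set_option linter.dupNamespace false

namespace Summit.NavierStokesRegularity.NavierStokesRegularity.Theorems.ScenarioCensus.RowA5HonestCell

open Literature.Analysis Literature.Analysis.FluidPDE Literature.Analysis.UnboundedOperators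
open Summit.NavierStokesRegularity.NavierStokesRegularity (AxisymmetricLiouvilleBoundedSwirl)
open Summit.NavierStokesRegularity.NavierStokesRegularity.Theorems.ScenarioCensus (Row_A5)
open Summit.NavierStokesRegularity.NavierStokesRegularity.Theorems.ScenarioCensus.PitchDefect (helical_transfer)
open Summit.NavierStokesRegularity.NavierStokesRegularity.Theorems.ScenarioCensus.RowA8HonestCell

/-- **Census cell A5gen (OPEN; ≡ the leaf / row A5 by `axisymmetricLiouvilleBoundedSwirl_iff_row_A5gen`).**
A genuine bounded continuous Oseen-mild field on `(−∞,T)`, EXACTLY axisymmetric about the FIXED `x₃`-axis,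
with bounded swirl `Γ = x₀ w₁ − x₁ w₀`, has constant slices — the classical KNSS 2009 §5 bounded-swirl
problem for honest solutions (Lei–Ren–Zhang form). -/
def Row_A5gen : Prop :=
  ∀ (T : ℝ) (w : ℝ → E3 → E3), IsGenuine T w → (∀ τ < T, FluidPDE.IsAxisymmetric (w τ)) →
    (∃ C : ℝ, ∀ τ < T, ∀ y, |FluidPDE.swirl (w τ) y| ≤ C) → ∀ τ < T, ∀ y, w τ y = w τ 0

/-! ## §5  Swirl transport through the gauge -/

/-- the swirl is continuous for a continuous field. -/
theorem continuous_swirl {f : E3 → E3} (hf : Continuous f) : Continuous fun y => FluidPDE.swirl f y := by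
  unfold FluidPDE.swirl
  have h0 : Continuous fun y : E3 => y 0 := (EuclideanSpace.proj (0 : Fin 3)).continuous
  have h1 : Continuous fun y : E3 => y 1 := (EuclideanSpace.proj (1 : Fin 3)).continuous
  have hf0 : Continuous fun y : E3 => f y 0 := (EuclideanSpace.proj (0 : Fin 3)).continuous.comp hf
  have hf1 : Continuous fun y : E3 => f y 1 := (EuclideanSpace.proj (1 : Fin 3)).continuous.comp hf
  exact (h0.mul hf1).sub (h1.mul hf0)

/-- a vertical shift of the argument and an axial constant do not change the swirl. -/
theorem swirl_shift_axial (f : E3 → E3) (ζ c₃ : ℝ) (x : E3) :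
    FluidPDE.swirl (fun y => f (y - ζ • e3) + c₃ • e3) x = FluidPDE.swirl f (x - ζ • e3) := by
  simp [FluidPDE.swirl, e3]

/-- an a.e. bound on a continuous real function is an everywhere bound. -/
theorem le_of_ae_le_of_continuous {g : E3 → ℝ} (hg : Continuous g) {C : ℝ}
    (h : ∀ᵐ y ∂(volume : Measure E3), g y ≤ C) : ∀ y, g y ≤ C := by
  have hmax : (fun y => max (g y) C) =ᵐ[volume] fun _ => C := by
    filter_upwards [h] with y hy
    exact max_eq_right hy
  have heq : (fun y => max (g y) C) = fun _ => C :=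
    (Continuous.ae_eq_iff_eq volume (hg.max continuous_const) continuous_const).1 hmax
  intro y
  have := congr_fun heq y
  exact (le_max_left _ _).trans this.le

/-- **Swirl transport.** If `u τ =ᵐ Z(· − ζ e₃) + c₃ e₃` with `Z` continuous and `|Γ(u τ)| ≤ C`
pointwise, then `|Γ(Z)| ≤ C` everywhere. -/
theorem swirl_bound_transport {uτ Z : E3 → E3} {ζ c₃ C : ℝ} (hZ : Continuous Z)
    (hrep : uτ =ᵐ[volume] fun x => Z (x - ζ • e3) + c₃ • e3) (hC : ∀ x, |FluidPDE.swirl uτ x| ≤ C) :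
    ∀ y, |FluidPDE.swirl Z y| ≤ C := by
  -- a.e. in `x`: `|Γ(Z)(x − ζ e₃)| ≤ C`
  have h1 : ∀ᵐ x ∂(volume : Measure E3), |FluidPDE.swirl Z (x - ζ • e3)| ≤ C := by
    filter_upwards [hrep] with x hx
    have e : FluidPDE.swirl uτ x = FluidPDE.swirl (fun y => Z (y - ζ • e3) + c₃ • e3) x := by
      simp only [FluidPDE.swirl, hx]
    rw [← swirl_shift_axial Z ζ c₃ x, ← e]
    exact hC x
  -- transport along the measure-preserving translation `y ↦ y + ζ e₃`
  have h2 : ∀ᵐ y ∂(volume : Measure E3), |FluidPDE.swirl Z y| ≤ C := by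
    have := (measurePreserving_add_right (volume : Measure E3) (ζ • e3)).quasiMeasurePreserving.ae h1
    filter_upwards [this] with y hy
    simpa only [add_sub_cancel_right] using hy
  exact le_of_ae_le_of_continuous ((continuous_swirl hZ).abs) h2

/-- screw symmetry of pitch `0` is axisymmetry. -/
theorem screw_zero_iff (f : E3 → E3) :
    (∀ (θ : ℝ) (x : E3), f (rotZ θ x + ((0 : ℝ) * θ) • e3) = rotZ θ (f x)) ↔ FluidPDE.IsAxisymmetric f := by
  simp only [zero_mul, zero_smul, add_zero]
  rfl

/-- **The honest reduction of the leaf** (kernel-checked): from the proved gauge facts O1/O2 (pitch 0),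
the axis dichotomy O3, Galilean boosts O5, forward rigidity F, the directional Liouville of the tree
(shear branch) and the swirl transport — the leaf follows from its honest cell A5gen. -/
theorem leaf_of_honest (hO1 : HelicalOseenGauge) (hO2 : TwistRigidity) (hO3 : AxisDichotomy)
    (hO5 : GalileanBoost) (hH : Row_A5gen) : AxisymmetricLiouvilleBoundedSwirl := by
  intro u hu hmeas haxi hswirl
  obtain ⟨C, hC⟩ := hswirl
  have hsym : ∀ t < 0, ∀ (θ : ℝ) (x : E3), u t (rotZ θ x + ((0 : ℝ) * θ) • e3) = rotZ θ (u t x) :=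
    fun t ht => (screw_zero_iff (u t)).2 (haxi t ht)
  obtain ⟨v, A, c, hgen, hA, hrep, hsymv⟩ := hO1 0 u hu hmeas hsym
  -- O2: the twist is constant; fix the reference gauge vector `cbar = c(−1)`
  set cbar : E3 := c (-1) with hcbar
  have htw : ∀ t < 0, ∀ θ : ℝ, rotZ θ (c t) - c t = rotZ θ cbar - cbar :=
    fun t ht θ => hO2 0 v A c hgen hsymv (-1) (by norm_num) t ht θ
  have hhor : ∀ t < 0, hor (c t) = hor cbar := fun t ht => hor_eq_of_twist (htw t ht)
  have hsymv' : ∀ t < 0, ∀ (θ : ℝ) (y : E3),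
      v t (rotZ θ y + (rotZ θ (A t) - A t + ((0 : ℝ) * θ) • e3)) = rotZ θ (v t y) + (rotZ θ cbar - cbar) := by
    intro t ht θ y; rw [hsymv t ht θ y, htw t ht θ]
  rcases hO3 0 v A cbar hgen hA hsymv' with hshear | ⟨τ₂, hτ₂, haff⟩
  · -- Case II: every slice is a horizontal shear; ONE direction of invariance already forces constancy
    have he : (EuclideanSpace.single 0 (1 : ℝ) : E3) ≠ 0 := by
      intro h
      have := congr_arg (fun w : E3 => w 0) h
      simp at this
    have hconst : ∀ τ < 0, ∀ y, v τ y = v τ 0 :=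
      hgen.eq_of_invariant_along he fun t ht x δ =>
        hshear t ht (δ • EuclideanSpace.single 0 (1 : ℝ)) (by simp) x
    intro t ht
    refine ⟨v t 0 + c t, ?_⟩
    filter_upwards [hrep t ht] with x hx
    rw [hx, hconst t ht]
  · -- Case I: on the backward end `τ ≤ τ₂` the axis moves uniformly with velocity `hor cbar`;
    -- boost honestly by that velocity: the boosted genuine field is EXACTLY axisymmetric.
    set k : E3 := hor cbar with hk
    set α : E3 := hor (A τ₂) - τ₂ • k with hα
    set Z : ℝ → E3 → E3 := fun τ y => v τ (y - α - τ • k) + k with hZ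
    have hZgen : IsGenuine τ₂ Z := (hO5 v α k hgen).mono hτ₂.le
    -- the representation of `u` through `Z` has AXIAL frame and gauge on `τ ≤ τ₂`
    have hrepZ : ∀ τ < τ₂, u τ =ᵐ[volume] fun x => Z τ (x - (A τ 2) • e3) + (c τ 2) • e3 := by
      intro τ hτ
      have hτ0 : τ < 0 := hτ.trans hτ₂
      have hAτ : A τ = α + τ • k + (A τ 2) • e3 := by
        calc A τ = hor (A τ) + (A τ 2) • e3 := self_eq_hor_add _
          _ = (hor (A τ₂) + (τ - τ₂) • k) + (A τ 2) • e3 := by rw [haff τ hτ.le]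
          _ = α + τ • k + (A τ 2) • e3 := by rw [hα, sub_smul]; abel
      have hcτ : c τ = k + (c τ 2) • e3 := by
        have h1 := self_eq_hor_add (c τ)
        rw [hhor τ hτ0] at h1
        exact h1
      have hxe : ∀ x : E3, x - (A τ 2) • e3 - α - τ • k = x - A τ := by
        intro x
        conv_rhs => rw [hAτ]
        abel
      filter_upwards [hrep τ hτ0] with x hx
      rw [hx]
      show v τ (x - A τ) + c τ = v τ (x - (A τ 2) • e3 - α - τ • k) + k + (c τ 2) • e3
      rw [hxe x, add_assoc, ← hcτ]
    -- exact axisymmetry of `Z τ` about the `x₃`-axis for `τ < τ₂`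
    have hZsym : ∀ τ < τ₂, ∀ (θ : ℝ) (y : E3), Z τ (rotZ θ y + ((0 : ℝ) * θ) • e3) = rotZ θ (Z τ y) := by
      intro τ hτ θ y
      have hτ0 : τ < 0 := hτ.trans hτ₂
      have key := helical_transfer (hZgen.continuous_slice hτ) (hsym τ hτ0 θ) (hrepZ τ hτ) y
      simp only [rotZ_smul_e3, sub_self, zero_add, add_zero] at key
      simpa only [zero_mul, zero_smul, add_zero] using key
    have hZaxi : ∀ τ < τ₂, FluidPDE.IsAxisymmetric (Z τ) := fun τ hτ => (screw_zero_iff (Z τ)).1 (hZsym τ hτ)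
    -- the swirl bound is transported through the gauge
    have hZswirl : ∀ τ < τ₂, ∀ y, |FluidPDE.swirl (Z τ) y| ≤ C := fun τ hτ =>
      swirl_bound_transport (hZgen.continuous_slice hτ) (hrepZ τ hτ) (hC τ (hτ.trans hτ₂))
    -- cell A5gen: `Z` has constant slices on `(−∞, τ₂)`; hence `u` has a.e.-constant slices there
    have hZconst := hH τ₂ Z hZgen hZaxi ⟨C, hZswirl⟩
    have hpast : ∀ s : ℝ, s < τ₂ → ∃ b : E3, u s =ᵐ[volume] fun _ => b := by
      intro s hs
      refine ⟨Z s 0 + (c s 2) • e3, ?_⟩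
      filter_upwards [hrepZ s hs] with x hx
      rw [hx, hZconst s hs]
    -- F: forward rigidity propagates to all `t < 0`
    exact forwardRigidity_holds u hu hmeas τ₂ hτ₂ hpast

/-- **Leaf ⇐ cell** with every support discharged in kernel. -/
theorem axisymmetricLiouvilleBoundedSwirl_of_row_A5gen (hH : Row_A5gen) :
    AxisymmetricLiouvilleBoundedSwirl :=
  leaf_of_honest helicalOseenGauge_holds twistRigidity_holds axisDichotomy_holds galileanBoost_holds hH

/-- **Cell ⇐ leaf**: a genuine exactly axisymmetric field with bounded swirl is in the duality class with
measurable slices, so the leaf makes its slices a.e. constant, hence constant (continuity); general `T` by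
the time shift. -/
theorem row_A5gen_of_axisymmetricLiouvilleBoundedSwirl (hA5 : AxisymmetricLiouvilleBoundedSwirl) :
    Row_A5gen := by
  intro T w hw haxi hsw τ hτ y
  obtain ⟨C, hC⟩ := hsw
  have hw0 : IsGenuine 0 fun σ y => w (σ + T) y := isGenuine_iff_shift_zero.1 hw
  have haxi0 : ∀ t < 0, FluidPDE.IsAxisymmetric ((fun σ y => w (σ + T) y) t) :=
    fun t ht => haxi (t + T) (by linarith)
  have hsw0 : ∃ C : ℝ, ∀ t < 0, ∀ x, |FluidPDE.swirl ((fun σ y => w (σ + T) y) t) x| ≤ C :=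
    ⟨C, fun t ht x => hC (t + T) (by linarith) x⟩
  obtain ⟨b, hb⟩ := hA5 _ hw0.isBoundedAncientMildSolution
    (fun t ht => (hw0.continuous_slice ht).aestronglyMeasurable) haxi0 hsw0 (τ - T) (by linarith)
  have hcont : Continuous fun y => w (τ - T + T) y := hw0.continuous_slice (t := τ - T) (by linarith)
  have heq : (fun y => w (τ - T + T) y) = fun _ => b :=
    (Continuous.ae_eq_iff_eq volume hcont continuous_const).1 hb
  have h1 := congr_fun heq y
  have h2 := congr_fun heq 0
  simp only [sub_add_cancel] at h1 h2
  rw [h1, h2]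

/-- **Headline (in kernel): the KNSS bounded-swirl leaf IS its honest cell.** -/
theorem axisymmetricLiouvilleBoundedSwirl_iff_row_A5gen :
    AxisymmetricLiouvilleBoundedSwirl ↔ Row_A5gen :=
  ⟨row_A5gen_of_axisymmetricLiouvilleBoundedSwirl,
    axisymmetricLiouvilleBoundedSwirl_of_row_A5gen⟩

end Summit.NavierStokesRegularity.NavierStokesRegularity.Theorems.ScenarioCensus.RowA5HonestCell

namespace Summit.NavierStokesRegularity.NavierStokesRegularity.Theorems.ScenarioCensus

/-- **Census alias: row A5 (the canonical bounded-swirl leaf) ≡ cell A5gen.** -/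
theorem axisymmetricLiouvilleBoundedSwirl_iff_row_A5gen :
    Summit.NavierStokesRegularity.NavierStokesRegularity.AxisymmetricLiouvilleBoundedSwirl ↔ RowA5HonestCell.Row_A5gen :=
  RowA5HonestCell.axisymmetricLiouvilleBoundedSwirl_iff_row_A5gen

/-- **Census alias: row A5 ≡ cell A5gen** (`Row_A5` is the leaf `AxisymmetricLiouvilleBoundedSwirl` by name). -/
theorem row_A5_iff_row_A5gen : Row_A5 ↔ RowA5HonestCell.Row_A5gen :=
  RowA5HonestCell.axisymmetricLiouvilleBoundedSwirl_iff_row_A5gen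

end Summit.NavierStokesRegularity.NavierStokesRegularity.Theorems.ScenarioCensus
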